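import Summits.HodgeConjecture.CorCM.HodgeEqualsLefschetzSimpleSurfaces
import Summits.HodgeConjecture.CorCM.MumfordTateRankTrivialEndomorphisms
import Literature.AlgebraicGeometry.HodgeTheory.GenericAbelianSurfacePowersHodgeClasses
import HarnessLib

/-!
# Abelian surfaces, sharp form: `End⁰B = ℚ ⟹ t = 11`, the exact table `11 / 7 / 3 / 4`, `t = 11 ⟺ End⁰B = ℚ`, and Hodge = Lefschetz for every simple surface

Sub-problem `CorCM` of `HodgeConjecture` (cell `pub-hodgecm2`, count-neutral Mumford–Tate-rank lane of seat `b27` gen 46; theorems only,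
no new definition, no named fact; UNCONDITIONAL — nothing here uses or asserts `HC_CM`).  `CorCM/MumfordTateRankTrivialEndomorphisms` left
the abelian surfaces with `End⁰B = ℚ` on `t ∈ {7, 11}`, and `CorCM/MumfordTateRankSimpleSurfaces` / `…Surfaces` / `HodgeEqualsLefschetzSimpleSurfaces`
carried that disjunction as a residual hypothesis.  The Literature theorem `mem_hodgeLie_iff_skew_of_surface_endRankOne`
(`HodgeTheory/GenericAbelianSurfacePowersHodgeClasses`, the tree's `SymplecticTheta` core: for `dim_ℚ H¹ = 4` and `End_Hdg(H¹) = ℚ` every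
admissible rational Lie algebra is `𝔰𝔭(H¹, ψ)`; Moonen–Zarhin (2.2) Type I(1) «`Hg(X) = Sp(V, φ) ≅ Sp_{4,ℚ}`») removes it:

* **`mtRank_hodge_one_eq_eleven_of_surface_of_finrank_endAlgebra_eq_one`** — EVERY abelian surface with `dim_ℚ End⁰B = 1` has
  `Lie Hg(H¹B) = 𝔰𝔭(H¹B, ψ)` (dimension `10`) and **`dim MT(H¹B) = 11`** (no simplicity hypothesis needed);
* **`mtRank_hodge_one_eq_eleven_iff_of_surface`** — for every abelian surface `t = 11 ⟺ dim_ℚ End⁰B = 1` (with `CorCM/MumfordTateRankSurfaces`);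
* `mtRank_hodge_one_of_isSimple_surface_sharp` — **the exact table for simple surfaces: `End⁰B = ℚ ↦ 11`, real quadratic `↦ 7`, quartic CM
  field `↦ 3`, indefinite quaternion `↦ 4`**; `t = 11 ⟺ End⁰B = ℚ` and `t = 7 ⟺ dim_ℚ End⁰B = 2`;
* **`hodgeLie_eq_lefschetz_of_isSimple_surface_sharp`** — Hodge = Lefschetz (`Lie Hg(H¹B) = C(End_Hdg(H¹B)) ∩ 𝔰𝔭(ψ)`) for EVERY simple complex
  abelian surface and every polarization (Moonen–Zarhin (2.2): `Hg = Sp_D(V, φ)` in all four cases, at the level of Lie algebras).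

## References
* [MoonenZarhin1999LowDim] B. Moonen, Yu. G. Zarhin, *Hodge classes on abelian varieties of low dimension*, Math. Ann. 315 (1999), §2 (2.2).
* [Milne1999LefschetzClasses] J. S. Milne, *Lefschetz classes on abelian varieties*, Duke Math. J. 96 (1999), §2 and Summary.
* [Humphreys1972] J. E. Humphreys, GTM 9 (1972), §1.2 (`dim 𝔰𝔭_{2ℓ} = ℓ(2ℓ+1)`).
-/

noncomputable section

namespace Summit.HodgeConjecture.CorCM

open scoped TensorProduct
open CategoryTheory CategoryTheory.Limits Module
open Literature.AlgebraicGeometry.Motives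
open Literature.AlgebraicGeometry.Motives.AbelianVariety
open Literature.AlgebraicGeometry.Motives.HodgeStructure
open Literature.AlgebraicGeometry.HodgeTheory
open Literature.AlgebraicGeometry.Milne1999 (IsOfCMType)
open Literature.Algebra.Lie

variable [HodgeTensorFacts.{0, 0}]

/-! ## §1 Every abelian surface with `End⁰B = ℚ`: `Lie Hg(H¹B) = 𝔰𝔭(H¹B, ψ)`, `t = 11` -/

/-- **An abelian SURFACE with `dim_ℚ End⁰B = 1` has `Lie Hg(H¹B) = 𝔰𝔭(H¹B, ψ)`** for every polarization `ψ` (Moonen–Zarhin (2.2) Type I(1)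
«`Hg(X) = Sp(V, φ) ≅ Sp_{4,ℚ}`», Lie form: the Literature theorem `mem_hodgeLie_iff_skew_of_surface_endRankOne`, read in the ladder's model
`exists_isReal_hodgeModel_holds` with an arbitrary smooth-projective witness). [cite: MoonenZarhin1999LowDim, §2 (2.2)] -/
theorem hodgeLie_eq_skewAdjoint_of_surface_of_finrank_endAlgebra_eq_one {B : AbelianVariety ℂ} {k : ℕ} (hB : IsSmoothProjective k B.X)
    (hB2 : B.dim = 2) (hE1 : Module.finrank ℚ B.endAlgebra = 1) [Module.Finite ℚ (bettiCohomology B.X 1)]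
    (ψ : (BettiUniverse.hodge exists_isReal_hodgeModel_holds hB 1).Polarization) :
    (BettiUniverse.hodge exists_isReal_hodgeModel_holds hB 1).hodgeLie = ψ.form.skewAdjointSubmodule := by
  have hk : B.dim = k := schemeDim_eq_holds hB
  subst hk
  ext Y
  rw [mem_hodgeLie_iff_skew_of_surface_endRankOne exists_isReal_hodgeModel_holds hodgePQ_independent_of_hodgeModel_holds hE1 hB2 ψ Y,
    LinearMap.mem_skewAdjointSubmodule]
  refine ⟨fun h v w => ?_, fun h v w => ?_⟩
  · rw [Pi.neg_apply, map_neg, ← add_eq_zero_iff_eq_neg]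
    exact h v w
  · have h' := h v w
    rw [Pi.neg_apply, map_neg, ← add_eq_zero_iff_eq_neg] at h'
    exact h'

/-- **An abelian SURFACE with `dim_ℚ End⁰B = 1` has `dim Lie Hg(H¹B) = 10` and `dim MT(H¹B) = 11`** (`Hg(B) = Sp₄`, of dimension
`10 = 2·(2·2+1)`; no simplicity hypothesis). This removes the value `7` left open by
`mtRank_hodge_one_eq_seven_or_eleven_of_surface_of_finrank_endAlgebra_eq_one`. [cite: MoonenZarhin1999LowDim, §2 (2.2)]
[cite: Humphreys1972, §1.2] -/
theorem mtRank_hodge_one_eq_eleven_of_surface_of_finrank_endAlgebra_eq_one {B : AbelianVariety ℂ} {k : ℕ}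
    (hB : IsSmoothProjective k B.X) (hB2 : B.dim = 2) (hE1 : Module.finrank ℚ B.endAlgebra = 1) :
    haveI := BettiUniverse.finite hB 1
    (BettiUniverse.hodge exists_isReal_hodgeModel_holds hB 1).mtRank = 11 ∧
      Module.finrank ℚ (BettiUniverse.hodge exists_isReal_hodgeModel_holds hB 1).hodgeLie = 10 := by
  classical
  haveI := BettiUniverse.finite hB 1
  have h0 : 0 < B.dim := by omega
  obtain ⟨ψ⟩ := BettiUniverse.hodge_isPolarizable exists_isReal_hodgeModel_holds hB 1
  have hflip : ψ.form.flip = -ψ.form := by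
    rw [ψ.flip_form, show (((1 : ℕ) : ℤ).negOnePow : ℤˣ) = -1 from Int.negOnePow_one, Units.val_neg, Units.val_one,
      neg_one_zsmul]
  have hs := SymplecticDimension.two_mul_finrank_skewAdjointSubmodule_of_flip_eq_neg ψ.form ψ.nondegenerate hflip
  rw [finrank_bettiCohomology_one_eq_two_mul_dim B, hB2] at hs
  have h10 : Module.finrank ℚ (BettiUniverse.hodge exists_isReal_hodgeModel_holds hB 1).hodgeLie = 10 := by
    rw [hodgeLie_eq_skewAdjoint_of_surface_of_finrank_endAlgebra_eq_one hB hB2 hE1 ψ]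
    omega
  rw [mtRank_hodge_one_eq_finrank_hodgeLie_add_one hB h0, h10]
  exact ⟨rfl, rfl⟩

/-- **For every abelian surface: `dim MT(H¹B) = 11 ⟺ dim_ℚ End⁰B = 1`** (`⟸` by §1; `⟹` is `CorCM/MumfordTateRankSurfaces`: `t = 11`
forces `B` simple with `End⁰B = ℚ`). [cite: MoonenZarhin1999LowDim, §2 (2.2)] -/
theorem mtRank_hodge_one_eq_eleven_iff_of_surface {B : AbelianVariety ℂ} {k : ℕ} (hB : IsSmoothProjective k B.X) (hB2 : B.dim = 2) :
    haveI := BettiUniverse.finite hB 1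
    (BettiUniverse.hodge exists_isReal_hodgeModel_holds hB 1).mtRank = 11 ↔ Module.finrank ℚ B.endAlgebra = 1 :=
  ⟨fun h => (isSimple_and_finrank_endAlgebra_eq_one_of_surface_of_mtRank_eq_eleven hB hB2 h).2,
    fun h => (mtRank_hodge_one_eq_eleven_of_surface_of_finrank_endAlgebra_eq_one hB hB2 h).1⟩

/-! ## §2 Simple surfaces: the exact table and Hodge = Lefschetz in all four cases -/

/-- **The exact Mumford–Tate rank of a simple complex abelian surface, by endomorphism type**: `End⁰B = ℚ ↦ 11`, real quadratic
field `↦ 7`, quartic CM field `↦ 3`, indefinite quaternion algebra `↦ 4`. [cite: MoonenZarhin1999LowDim, §2 (2.2)] -/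
theorem mtRank_hodge_one_of_isSimple_surface_sharp {B : AbelianVariety ℂ} {k : ℕ} (hB : IsSmoothProjective k B.X)
    (hBs : B.IsSimple) (hB2 : B.dim = 2) :
    haveI := BettiUniverse.finite hB 1
    (Module.finrank ℚ B.endAlgebra = 1 ∧ (BettiUniverse.hodge exists_isReal_hodgeModel_holds hB 1).mtRank = 11) ∨
      (Module.finrank ℚ B.endAlgebra = 2 ∧ (BettiUniverse.hodge exists_isReal_hodgeModel_holds hB 1).mtRank = 7) ∨
      (Module.finrank ℚ B.endAlgebra = 4 ∧ (∀ x y : B.endAlgebra, x * y = y * x) ∧ IsOfCMType B ∧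
        (BettiUniverse.hodge exists_isReal_hodgeModel_holds hB 1).mtRank = 3) ∨
      (Module.finrank ℚ B.endAlgebra = 4 ∧ (∃ x y : B.endAlgebra, x * y ≠ y * x) ∧
        (BettiUniverse.hodge exists_isReal_hodgeModel_holds hB 1).mtRank = 4) := by
  rcases mtRank_hodge_one_of_isSimple_surface hB hBs hB2 with ⟨h1, -⟩ | h | h | h
  · exact Or.inl ⟨h1, (mtRank_hodge_one_eq_eleven_of_surface_of_finrank_endAlgebra_eq_one hB hB2 h1).1⟩
  · exact Or.inr (Or.inl h)
  · exact Or.inr (Or.inr (Or.inl h))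
  · exact Or.inr (Or.inr (Or.inr h))

/-- **For a simple abelian surface: `t = 11 ⟺ End⁰B = ℚ`, and `t = 7 ⟺ dim_ℚ End⁰B = 2` (real multiplication).**
[cite: MoonenZarhin1999LowDim, §2 (2.2)] -/
theorem mtRank_hodge_one_eq_eleven_iff_and_eq_seven_iff_of_isSimple_surface {B : AbelianVariety ℂ} {k : ℕ}
    (hB : IsSmoothProjective k B.X) (hBs : B.IsSimple) (hB2 : B.dim = 2) :
    haveI := BettiUniverse.finite hB 1
    ((BettiUniverse.hodge exists_isReal_hodgeModel_holds hB 1).mtRank = 11 ↔ Module.finrank ℚ B.endAlgebra = 1) ∧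
      ((BettiUniverse.hodge exists_isReal_hodgeModel_holds hB 1).mtRank = 7 ↔ Module.finrank ℚ B.endAlgebra = 2) := by
  rcases mtRank_hodge_one_of_isSimple_surface_sharp hB hBs hB2 with ⟨h1, h⟩ | ⟨h2, h⟩ | ⟨h4, -, -, h⟩ | ⟨h4, -, h⟩ <;>
    exact ⟨⟨fun h' => by omega, fun h' => by omega⟩, ⟨fun h' => by omega, fun h' => by omega⟩⟩

/-- **Hodge = Lefschetz for EVERY simple complex abelian surface**: `Lie Hg(H¹B) = C(End_Hdg(H¹B)) ∩ 𝔰𝔭(ψ)` for every polarization `ψ`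
(Moonen–Zarhin (2.2): `Hg(B) = Sp_D(V, φ)` in all four cases; the residual hypothesis of `hodgeLie_eq_lefschetz_of_isSimple_surface` is
discharged by §1). [cite: MoonenZarhin1999LowDim, §2 (2.2)] [cite: Milne1999LefschetzClasses, §2 and Summary] -/
theorem hodgeLie_eq_lefschetz_of_isSimple_surface_sharp {B : AbelianVariety ℂ} {k : ℕ} (hB : IsSmoothProjective k B.X)
    (hBs : B.IsSimple) (hB2 : B.dim = 2) [Module.Finite ℚ (bettiCohomology B.X 1)]
    (ψ : (BettiUniverse.hodge exists_isReal_hodgeModel_holds hB 1).Polarization) :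
    (BettiUniverse.hodge exists_isReal_hodgeModel_holds hB 1).hodgeLie =
      Subalgebra.toSubmodule (Subalgebra.centralizer ℚ
          ((BettiUniverse.hodge exists_isReal_hodgeModel_holds hB 1).endAlg : Set (Module.End ℚ (bettiCohomology B.X 1)))) ⊓
        ψ.form.skewAdjointSubmodule := by
  by_cases h1 : Module.finrank ℚ B.endAlgebra = 1
  · exact hodgeLie_eq_lefschetz_of_isSimple_surface hB hBs hB2 ψ
      (Or.inr (mtRank_hodge_one_eq_eleven_of_surface_of_finrank_endAlgebra_eq_one hB hB2 h1).1)
  · exact hodgeLie_eq_lefschetz_of_isSimple_surface hB hBs hB2 ψ (Or.inl h1)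

end Summit.HodgeConjecture.CorCM

end
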